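import Summits.QuantumFields.BalabanUV.Beta.FP.PerfectSymbol166StripReg
import Summits.QuantumFields.BalabanUV.Beta.FP.PerfectSymbolPerm

/-!
# `BalabanUV.Beta.FP.PerfectSymbol166RealLine` — road «FP» (binder row D1), sub-row **W166-HOLO**, PART D: THE REAL-LINE DERIVATIVE PACKAGE OF THE
# CONTINUUM (1.66) MULTIPLIER — the coordinate-slice derivatives `∂_iʲ W_∞` as multipliers `DW j`, their `HasDerivAt` chain ∕ continuity ∕
# `2π`-periodicity (endpoint matching) along every real coordinate line of the Brillouin zone, CAUCHY BOUNDS `‖∂_iʲ W_∞‖ ≤ j!·M₁₆₆∕(δ₁₆₆∕2)ʲ`, and the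
# first-order VANISHING `‖∂_i W_∞(s)‖ ≤ C·|s_i|` from coordinate evenness — the `W_∞`-inputs of rows H2-P-REG ∕ H2-P-B ∕ H2-P-IBP (`LEAVES-FP.md`)

HONEST FRAMING (cell contract, verbatim): «discharging `BetaPertH` makes Bałaban's UV stability UNCONDITIONAL — a real constructive-QFT
result; it is NOT the continuum limit and NOT the Clay problem.»  HONEST DEPENDENCY (verbatim): «continuum YM on T⁴ ⇐ BetaPertH ∧ nine
spine estimates (0/9 proved); BetaPertH ⇐ (D1) ∧ (D4) ∧ CAP+tail; G-an2-4 gates asym, D1 and NE2/3/4.»  THIS MODULE DISCHARGES NOTHING of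
D1 / BetaPertH: [folklore] one-variable complex analysis (identity theorem, Cauchy estimates, real restriction of holomorphic functions) over PART B
(`delta166`, `bound166`, `differentiableAt_W166Inf_slice_fatStripO`, `W166Inf_sides`) and `PerfectSymbolPerm.W166Inf_cflip` BY NAME.  No `def … : Prop`;
nothing is cited; 0 sorry.  NOT summit progress; NOT BetaPertH, NOT continuum, NOT Clay.

ABSOLUTE RULE (cell, verbatim): «No internally-minted statement may enter as a cited fact. Every hypothesis is either kernel-proved in this
package or a verbatim quotation of a PUBLISHED theorem with page reference. The manuscript(s) under audit are NOT citable for their own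
disputed steps — they are the thing under adjudication; programme-internal (2001/route/tribunal) claims are never citable.»

CONTENT (lattice dimension `d + 1`, transverse real point `q ∈ BZ d = [-π,π]^d`, coordinate `i`, `κ₀ = κ₁₆₆(d+1)`, `δ₀ = δ₁₆₆(d+1)`, `M = M₁₆₆(d+1)`;
currency of `B4ContourShift.fourierBox_eq_iterated` ∕ `Beta.AliasingTailDeriv.fourierBox_coordDeriv`: slices `t ↦ F (i.insertNth (t:ℂ) (ofRealVec q))`).
* §1 the complex slice `sliceW μ ν i q z := W_∞(μ,ν; insertNth i z q)` is holomorphic on the open fat rectangle `{|Re z| < π + δ₀, |Im z| < κ₀ + δ₀}`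
  (`differentiableOn_sliceW`, `analyticOnNhd_sliceW`) and bounded by `M` on the closed one (`norm_sliceW_le`).
* §2 the MULTIPLIERS `DW j μ ν i p := iteratedDeriv j (z ↦ W_∞(μ,ν; update p i z)) (p i)` (`DW 0 = W_∞`; `DW_insertNth`: on the slice they are
  `iteratedDeriv j (sliceW …)`), CAUCHY BOUNDS **`norm_DW_insertNth_le : t ∈ [-π,π] → ‖DW j μ ν i (insertNth i t q)‖ ≤ j!·M∕(δ₀∕2)^j`**.
* §3 the real-line chain: **`hasDerivAt_DW_ofReal`** (`HasDerivAt (s ↦ DW j … (insertNth i s q)) (DW (j+1) … (insertNth i t q)) t` on the open interval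
  `|t| < π + δ₀`), **`continuousOn_DW_ofReal`** (on `[-π, π]`, indeed on the open interval).
* §4 `2π`-PERIODICITY BY THE IDENTITY THEOREM: `h(z) = sliceW (z + 2π) − sliceW z` is holomorphic near the segment `Re z = −π` and vanishes on it
  (`W166Inf_sides`), hence identically near it (`AnalyticOnNhd.eqOn_zero_of_preconnected_of_frequently_eq_zero`): `sliceW_add_two_pi`, whence
  **`DW_periodic : DW j μ ν i (insertNth i (−π) q) = DW j μ ν i (insertNth i π q)`** for EVERY `j` (endpoint matching of all derivatives; `μ ≠ ν`).
* §5 EVENNESS in the coordinate (`W166Inf_cflip`): `sliceW_neg`, `DW_one_center` (`∂_i W_∞ = 0` at `s_i = 0`), and the first-order vanishing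
  **`norm_DW_one_le_mul_abs : t ∈ [-π,π] → ‖DW 1 μ ν i (insertNth i t q)‖ ≤ (2·M∕(δ₀∕2)²)·|t|`** (mean value inequality with the `j = 2` Cauchy bound).
Unit `b2b-balaban-beta-d1-formalise-leaf-01` (gen 8).
-/

noncomputable section

namespace Summit.QuantumFields.BalabanUV.Beta.FP.PerfectSymbol166RealLine

open Filter Topology Finset Complex Set Metric
open scoped BigOperators
open Literature.MathematicalPhysics.QuantumFieldTheory.Balaban1983to89
open B4Strip (Strip ofRealVec)
open B5Symbol166Strip (kappa166 kappa166_pos)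
open B4ContourShift (BZ)
open Summit.QuantumFields.BalabanUV.Beta.FP.PerfectSymbolAlias
open Summit.QuantumFields.BalabanUV.Beta.FP.PerfectSymbol166
open Summit.QuantumFields.BalabanUV.Beta.FP.PerfectSymbol166Holo
open Summit.QuantumFields.BalabanUV.Beta.FP.PerfectSymbol166StripReg
open Beta.AliasingTailL1 (update_insertNth_same)
open Summit.QuantumFields.BalabanUV.Beta.FP.PerfectSymbolPerm (cflip W166Inf_cflip)

variable {d : ℕ}

/-! ## §1 The complex coordinate slice through a real transverse point -/

/-- [our object] the complex slice of `W_∞(μ,ν;·)` in coordinate `i` through the real transverse point `q`: `z ↦ W_∞(μ,ν; insertNth i z q)`. -/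
def sliceW (μ ν i : Fin (d + 1)) (q : Fin d → ℝ) (z : ℂ) : ℂ := W166Inf μ ν (i.insertNth z (ofRealVec q))

/-- [our object] the open fat rectangle `{|Re z| < π + δ, |Im z| < κ + δ}`. -/
def fatRectO (κ δ : ℝ) : Set ℂ := {z | |z.re| < Real.pi + δ ∧ |z.im| < κ + δ}

/-- [folklore] the open fat rectangle is open. -/
theorem isOpen_fatRectO (κ δ : ℝ) : IsOpen (fatRectO κ δ) :=
  (isOpen_lt (continuous_abs.comp Complex.continuous_re) continuous_const).inter
    (isOpen_lt (continuous_abs.comp Complex.continuous_im) continuous_const)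

/-- [folklore] inserting a point of the open fat rectangle at coordinate `i` into a real zone point gives a point of the open fat strip
(`0 < δ`, `0 ≤ κ`). -/
theorem insertNth_mem_fatStripO {κ δ : ℝ} (hκ : 0 ≤ κ) (hδ : 0 < δ) (i : Fin (d + 1)) {q : Fin d → ℝ} (hq : q ∈ BZ d) {z : ℂ}
    (hz : z ∈ fatRectO κ δ) : (i.insertNth z (ofRealVec q) : Fin (d + 1) → ℂ) ∈ FatStripO (d + 1) κ δ := by
  intro j
  refine Fin.succAboveCases i ?_ ?_ j
  · rw [Fin.insertNth_apply_same]; exact hz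
  · intro k
    rw [Fin.insertNth_apply_succAbove]
    simp only [ofRealVec, Complex.ofReal_re, Complex.ofReal_im, abs_zero]
    exact ⟨by have := abs_le.mpr ⟨hq.1 k, hq.2 k⟩; linarith, by linarith⟩

/-- [folklore] … and a point of the CLOSED fat rectangle gives a point of the closed fat strip (`0 ≤ δ`, `0 ≤ κ`). -/
theorem insertNth_mem_fatStrip {κ δ : ℝ} (hκ : 0 ≤ κ) (hδ : 0 ≤ δ) (i : Fin (d + 1)) {q : Fin d → ℝ} (hq : q ∈ BZ d) {z : ℂ}
    (hz : |z.re| ≤ Real.pi + δ ∧ |z.im| ≤ κ + δ) : (i.insertNth z (ofRealVec q) : Fin (d + 1) → ℂ) ∈ FatStrip (d + 1) κ δ := by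
  intro j
  refine Fin.succAboveCases i ?_ ?_ j
  · rw [Fin.insertNth_apply_same]; exact hz
  · intro k
    rw [Fin.insertNth_apply_succAbove]
    simp only [ofRealVec, Complex.ofReal_re, Complex.ofReal_im, abs_zero]
    exact ⟨by have := abs_le.mpr ⟨hq.1 k, hq.2 k⟩; linarith, by linarith⟩

/-- [folklore] **the slice is holomorphic on the open fat rectangle** `{|Re z| < π + δ₀, |Im z| < κ₀ + δ₀}` (`κ₀ = κ₁₆₆(d+1)`, `δ₀ = δ₁₆₆(d+1)`). -/
theorem differentiableOn_sliceW (μ ν i : Fin (d + 1)) {q : Fin d → ℝ} (hq : q ∈ BZ d) :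
    DifferentiableOn ℂ (sliceW μ ν i q) (fatRectO (kappa166 (d + 1)) (delta166 (d + 1))) := by
  intro z hz
  have hp := insertNth_mem_fatStripO (kappa166_pos _).le (delta166_pos _) i hq hz
  have h := differentiableAt_W166Inf_slice_fatStripO hp i μ ν
  rw [Fin.insertNth_apply_same] at h
  refine (h.congr_of_eventuallyEq (Eventually.of_forall fun w => ?_)).differentiableWithinAt
  show sliceW μ ν i q w = W166Inf μ ν (Function.update (i.insertNth z (ofRealVec q)) i w)
  rw [update_insertNth_same]; rfl

/-- [folklore] … hence analytic there. -/
theorem analyticOnNhd_sliceW (μ ν i : Fin (d + 1)) {q : Fin d → ℝ} (hq : q ∈ BZ d) :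
    AnalyticOnNhd ℂ (sliceW μ ν i q) (fatRectO (kappa166 (d + 1)) (delta166 (d + 1))) :=
  (Complex.analyticOnNhd_iff_differentiableOn (isOpen_fatRectO _ _)).mpr (differentiableOn_sliceW μ ν i hq)

/-- [folklore] **the slice is bounded by `M₁₆₆(d+1)` on the closed fat rectangle.** -/
theorem norm_sliceW_le (μ ν i : Fin (d + 1)) {q : Fin d → ℝ} (hq : q ∈ BZ d) {z : ℂ}
    (hz : |z.re| ≤ Real.pi + delta166 (d + 1) ∧ |z.im| ≤ kappa166 (d + 1) + delta166 (d + 1)) : ‖sliceW μ ν i q z‖ ≤ bound166 (d + 1) :=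
  norm_W166Inf_le_bound166 μ ν (insertNth_mem_fatStrip (kappa166_pos _).le (delta166_pos _).le i hq hz)

/-! ## §2 The slice-derivative multipliers `DW j` and their Cauchy bounds -/

/-- [our object] **THE `j`-TH COORDINATE-SLICE DERIVATIVE OF `W_∞` AS A MULTIPLIER**: `DW j μ ν i p := (d/dz)^j W_∞(μ,ν; update p i z) |_{z = p i}`
(complex derivative; on real coordinate lines it is the real derivative, §3). -/
def DW {n : ℕ} (j : ℕ) (μ ν i : Fin n) (p : Fin n → ℂ) : ℂ := iteratedDeriv j (fun z : ℂ => W166Inf μ ν (Function.update p i z)) (p i)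

/-- [folklore] `DW 0 = W_∞`. -/
theorem DW_zero {n : ℕ} (μ ν i : Fin n) (p : Fin n → ℂ) : DW 0 μ ν i p = W166Inf μ ν p := by
  simp [DW, iteratedDeriv_zero]

/-- [folklore] on the slice through `q`, `DW j` IS the `j`-th derivative of `sliceW`: `DW j μ ν i (insertNth i z q) = iteratedDeriv j (sliceW μ ν i q) z`. -/
theorem DW_insertNth (j : ℕ) (μ ν i : Fin (d + 1)) (q : Fin d → ℝ) (z : ℂ) :
    DW j μ ν i (i.insertNth z (ofRealVec q)) = iteratedDeriv j (sliceW μ ν i q) z := by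
  unfold DW
  rw [Fin.insertNth_apply_same]
  congr 1
  funext w
  rw [update_insertNth_same]; rfl

/-- [folklore] points within `δ₀/2` of a real `t ∈ [-π, π]` lie in the closed fat rectangle of radius `δ₀` (strictly inside the open one). -/
theorem near_real_mem {t : ℝ} (ht : t ∈ Set.Icc (-Real.pi) Real.pi) {w : ℂ} (hw : ‖w - t‖ ≤ delta166 (d + 1) / 2) :
    |w.re| ≤ Real.pi + delta166 (d + 1) / 2 ∧ |w.im| ≤ delta166 (d + 1) / 2 := by
  have hre : |w.re - t| ≤ delta166 (d + 1) / 2 := by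
    have := Complex.abs_re_le_norm (w - t); simp only [Complex.sub_re, Complex.ofReal_re] at this; linarith
  have him : |w.im| ≤ delta166 (d + 1) / 2 := by
    have := Complex.abs_im_le_norm (w - t); simp only [Complex.sub_im, Complex.ofReal_im, sub_zero] at this; linarith
  have ht' : |t| ≤ Real.pi := abs_le.mpr ⟨ht.1, ht.2⟩
  refine ⟨?_, him⟩
  calc |w.re| = |(w.re - t) + t| := by ring_nf
    _ ≤ |w.re - t| + |t| := abs_add_le _ _
    _ ≤ Real.pi + delta166 (d + 1) / 2 := by linarith

/-- [folklore] for a real `t ∈ [-π, π]` the closed disc of radius `δ₀/2` around `t` lies in the open fat rectangle. -/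
theorem closedBall_subset_fatRectO {t : ℝ} (ht : t ∈ Set.Icc (-Real.pi) Real.pi) :
    closedBall (t : ℂ) (delta166 (d + 1) / 2) ⊆ fatRectO (kappa166 (d + 1)) (delta166 (d + 1)) := by
  intro w hw
  have hδ := delta166_pos (d + 1)
  have hκ := kappa166_pos (d + 1)
  rw [mem_closedBall, Complex.dist_eq] at hw
  obtain ⟨h1, h2⟩ := near_real_mem (d := d) ht hw
  exact ⟨by linarith, by linarith⟩

/-- [folklore] **CAUCHY BOUNDS ON THE SLICE DERIVATIVES**: for `q ∈ [-π,π]^d`, real `t ∈ [-π, π]` and every `j`,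
`‖iteratedDeriv j (sliceW μ ν i q) t‖ ≤ j!·M₁₆₆∕(δ₁₆₆∕2)^j` (`Complex.norm_iteratedDeriv_le_of_forall_mem_sphere_norm_le` on the disc of radius `δ₁₆₆/2`). -/
theorem norm_iteratedDeriv_sliceW_le (j : ℕ) (μ ν i : Fin (d + 1)) {q : Fin d → ℝ} (hq : q ∈ BZ d) {t : ℝ}
    (ht : t ∈ Set.Icc (-Real.pi) Real.pi) :
    ‖iteratedDeriv j (sliceW μ ν i q) (t : ℂ)‖ ≤ j.factorial * bound166 (d + 1) / (delta166 (d + 1) / 2) ^ j := by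
  have hδ := delta166_pos (d + 1)
  have hκ := kappa166_pos (d + 1)
  have hR : 0 < delta166 (d + 1) / 2 := by linarith
  have hdc : DiffContOnCl ℂ (sliceW μ ν i q) (ball (t : ℂ) (delta166 (d + 1) / 2)) :=
    (differentiableOn_sliceW μ ν i hq).diffContOnCl_ball (closedBall_subset_fatRectO (d := d) ht)
  refine Complex.norm_iteratedDeriv_le_of_forall_mem_sphere_norm_le j hR hdc fun z hz => ?_
  have hz' : ‖z - t‖ ≤ delta166 (d + 1) / 2 := by
    have := sphere_subset_closedBall hz; rwa [mem_closedBall, Complex.dist_eq] at this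
  obtain ⟨h1, h2⟩ := near_real_mem (d := d) ht hz'
  exact norm_sliceW_le μ ν i hq ⟨by linarith, by linarith⟩

/-- [folklore] **THE CAUCHY BOUNDS FOR THE MULTIPLIERS `DW j` ON THE REAL ZONE**: `‖DW j μ ν i (insertNth i t q)‖ ≤ j!·M₁₆₆∕(δ₁₆₆∕2)^j` for `q ∈ [-π,π]^d`,
`t ∈ [-π, π]` — uniform in `q`, `t`, `μ`, `ν`, `i`. -/
theorem norm_DW_insertNth_le (j : ℕ) (μ ν i : Fin (d + 1)) {q : Fin d → ℝ} (hq : q ∈ BZ d) {t : ℝ} (ht : t ∈ Set.Icc (-Real.pi) Real.pi) :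
    ‖DW j μ ν i (i.insertNth (t : ℂ) (ofRealVec q))‖ ≤ j.factorial * bound166 (d + 1) / (delta166 (d + 1) / 2) ^ j := by
  rw [DW_insertNth]; exact norm_iteratedDeriv_sliceW_le j μ ν i hq ht

/-! ## §3 The real-line chain: derivatives and continuity along the real coordinate line -/

/-- [folklore] a real `t` with `|t| < π + δ₀` is a point of the open fat rectangle. -/
theorem ofReal_mem_fatRectO {t : ℝ} (ht : |t| < Real.pi + delta166 (d + 1)) :
    (t : ℂ) ∈ fatRectO (kappa166 (d + 1)) (delta166 (d + 1)) := by
  refine ⟨by simpa using ht, ?_⟩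
  simp only [Complex.ofReal_im, abs_zero]
  linarith [kappa166_pos (d + 1), delta166_pos (d + 1)]

/-- [folklore] the `j`-th slice derivative is holomorphic on the open fat rectangle. -/
theorem differentiableOn_iteratedDeriv_sliceW (j : ℕ) (μ ν i : Fin (d + 1)) {q : Fin d → ℝ} (hq : q ∈ BZ d) :
    DifferentiableOn ℂ (iteratedDeriv j (sliceW μ ν i q)) (fatRectO (kappa166 (d + 1)) (delta166 (d + 1))) := by
  rw [iteratedDeriv_eq_iterate]
  exact ((analyticOnNhd_sliceW μ ν i hq).iterated_deriv j).differentiableOn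

/-- [folklore] **THE `HasDerivAt` CHAIN ON THE REAL LINE**: for `q ∈ [-π,π]^d` and real `t` with `|t| < π + δ₀`,
`HasDerivAt (s ↦ DW j μ ν i (insertNth i s q)) (DW (j+1) μ ν i (insertNth i t q)) t` — the real derivative of the `j`-th multiplier along the
coordinate line is the `(j+1)`-st (hypothesis `hder` of the integration-by-parts engines, on the whole OPEN interval `(-π-δ₀, π+δ₀) ⊇ [-π, π]`). -/
theorem hasDerivAt_DW_ofReal (j : ℕ) (μ ν i : Fin (d + 1)) {q : Fin d → ℝ} (hq : q ∈ BZ d) {t : ℝ} (ht : |t| < Real.pi + delta166 (d + 1)) :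
    HasDerivAt (fun s : ℝ => DW j μ ν i (i.insertNth (s : ℂ) (ofRealVec q))) (DW (j + 1) μ ν i (i.insertNth (t : ℂ) (ofRealVec q))) t := by
  simp only [DW_insertNth]
  rw [iteratedDeriv_succ]
  have hdiff : DifferentiableAt ℂ (iteratedDeriv j (sliceW μ ν i q)) (t : ℂ) :=
    (differentiableOn_iteratedDeriv_sliceW j μ ν i hq).differentiableAt ((isOpen_fatRectO _ _).mem_nhds (ofReal_mem_fatRectO ht))
  exact hdiff.hasDerivAt.comp_ofReal

/-- [folklore] **CONTINUITY ON THE REAL LINE**: `s ↦ DW j μ ν i (insertNth i s q)` is continuous on `[-π, π]` (hypothesis `hcont`). -/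
theorem continuousOn_DW_ofReal (j : ℕ) (μ ν i : Fin (d + 1)) {q : Fin d → ℝ} (hq : q ∈ BZ d) :
    ContinuousOn (fun s : ℝ => DW j μ ν i (i.insertNth (s : ℂ) (ofRealVec q))) (Set.Icc (-Real.pi) Real.pi) := by
  intro t ht
  have ht' : |t| < Real.pi + delta166 (d + 1) := by
    have := abs_le.mpr ⟨ht.1, ht.2⟩; linarith [delta166_pos (d + 1)]
  exact (hasDerivAt_DW_ofReal j μ ν i hq ht').continuousAt.continuousWithinAt

/-- [folklore] the same on the symmetric open interval `(-(π+δ₀), π+δ₀)`. -/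
theorem continuousOn_DW_ofReal_Ioo (j : ℕ) (μ ν i : Fin (d + 1)) {q : Fin d → ℝ} (hq : q ∈ BZ d) :
    ContinuousOn (fun s : ℝ => DW j μ ν i (i.insertNth (s : ℂ) (ofRealVec q)))
      (Set.Ioo (-(Real.pi + delta166 (d + 1))) (Real.pi + delta166 (d + 1))) := fun _ ht =>
  (hasDerivAt_DW_ofReal j μ ν i hq (abs_lt.mpr ⟨ht.1, ht.2⟩)).continuousAt.continuousWithinAt

/-! ## §4 `2π`-periodicity of all slice derivatives (identity theorem) -/

/-- [our object] the open neighbourhood of the left side segment on which both `z` and `z + 2π` lie in the fat rectangle: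
`{−π − δ < Re z < −π + δ, |Im z| < κ + δ}`. -/
def sideNbhd (κ δ : ℝ) : Set ℂ := {z | -Real.pi - δ < z.re ∧ z.re < -Real.pi + δ ∧ |z.im| < κ + δ}

/-- [folklore] the side neighbourhood is open. -/
theorem isOpen_sideNbhd (κ δ : ℝ) : IsOpen (sideNbhd κ δ) := by
  have e : sideNbhd κ δ = ({z : ℂ | -Real.pi - δ < z.re} ∩ {z : ℂ | z.re < -Real.pi + δ}) ∩ {z : ℂ | |z.im| < κ + δ} := by
    ext z; simp only [sideNbhd, Set.mem_setOf_eq, Set.mem_inter_iff, and_assoc]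
  rw [e]
  exact ((isOpen_lt continuous_const Complex.continuous_re).inter (isOpen_lt Complex.continuous_re continuous_const)).inter
    (isOpen_lt (continuous_abs.comp Complex.continuous_im) continuous_const)

/-- [folklore] the side neighbourhood is convex, hence preconnected. -/
theorem isPreconnected_sideNbhd (κ δ : ℝ) : IsPreconnected (sideNbhd κ δ) := by
  have e : sideNbhd κ δ = ({z : ℂ | -Real.pi - δ < z.re} ∩ {z : ℂ | z.re < -Real.pi + δ}) ∩
      ({z : ℂ | -(κ + δ) < z.im} ∩ {z : ℂ | z.im < κ + δ}) := by
    ext z; simp only [sideNbhd, Set.mem_setOf_eq, Set.mem_inter_iff, abs_lt]; tauto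
  rw [e]
  exact (((convex_halfSpace_re_gt _).inter (convex_halfSpace_re_lt _)).inter
    ((convex_halfSpace_im_gt _).inter (convex_halfSpace_im_lt _))).isPreconnected

/-- [folklore] points of the side neighbourhood and their `2π`-translates lie in the open fat rectangle (`δ ≤ π`). -/
theorem sideNbhd_mem {κ δ : ℝ} {z : ℂ} (hz : z ∈ sideNbhd κ δ) (hδπ : δ ≤ Real.pi) :
    z ∈ fatRectO κ δ ∧ z + 2 * Real.pi ∈ fatRectO κ δ := by
  obtain ⟨h1, h2, h3⟩ := hz
  have hπ := Real.pi_pos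
  refine ⟨⟨abs_lt.mpr ⟨by linarith, by linarith⟩, h3⟩, ⟨?_, ?_⟩⟩
  · have : (z + 2 * Real.pi).re = z.re + 2 * Real.pi := by simp
    rw [this]; exact abs_lt.mpr ⟨by linarith, by linarith⟩
  · have : (z + 2 * Real.pi).im = z.im := by simp
    rw [this]; exact h3

/-- [folklore] `δ₁₆₆(n) ≤ π` (indeed `δ₁₆₆ < rOf ≤ 1/4 < π`). -/
theorem delta166_le_pi (n : ℕ) : delta166 n ≤ Real.pi := by
  have h1 := delta166_lt_rOf n
  have h2 := B4StripCauchy.rOf_le n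
  have h3 := Real.pi_gt_three
  linarith

/-- [folklore] **`2π`-PERIODICITY OF THE SLICE NEAR THE LEFT SIDE (identity theorem)**: for `μ ≠ ν`, `q ∈ [-π,π]^d` and `z` in the side neighbourhood,
`sliceW μ ν i q (z + 2π) = sliceW μ ν i q z` — the difference is holomorphic on the (connected) side neighbourhood and vanishes on the segment
`{−π + iy : |y| ≤ κ₀}` (`W166Inf_sides`), which accumulates at `−π`. -/
theorem sliceW_add_two_pi {μ ν : Fin (d + 1)} (hμν : μ ≠ ν) (i : Fin (d + 1)) {q : Fin d → ℝ} (hq : q ∈ BZ d) {z : ℂ}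
    (hz : z ∈ sideNbhd (kappa166 (d + 1)) (delta166 (d + 1))) : sliceW μ ν i q (z + 2 * Real.pi) = sliceW μ ν i q z := by
  set U := sideNbhd (kappa166 (d + 1)) (delta166 (d + 1)) with hU
  set h : ℂ → ℂ := fun w => sliceW μ ν i q (w + 2 * Real.pi) - sliceW μ ν i q w with hh
  have hδπ := delta166_le_pi (d + 1)
  -- `h` is analytic on `U`
  have hdiff : DifferentiableOn ℂ h U := by
    intro w hw
    obtain ⟨hw1, hw2⟩ := sideNbhd_mem hw hδπ
    have hO := isOpen_fatRectO (kappa166 (d + 1)) (delta166 (d + 1))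
    have d1 : DifferentiableAt ℂ (sliceW μ ν i q) (w + 2 * Real.pi) :=
      (differentiableOn_sliceW μ ν i hq).differentiableAt (hO.mem_nhds hw2)
    have d2 : DifferentiableAt ℂ (sliceW μ ν i q) w := (differentiableOn_sliceW μ ν i hq).differentiableAt (hO.mem_nhds hw1)
    exact ((d1.comp w (differentiableAt_id.add_const _)).sub d2).differentiableWithinAt
  have han : AnalyticOnNhd ℂ h U := (Complex.analyticOnNhd_iff_differentiableOn (isOpen_sideNbhd _ _)).mpr hdiff
  -- the base point `−π` and the zeros `−π + iy`
  have hκ := kappa166_pos (d + 1)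
  have hδ := delta166_pos (d + 1)
  have h0U : (-(Real.pi : ℂ)) ∈ U := by
    refine ⟨?_, ?_, ?_⟩
    · simp only [Complex.neg_re, Complex.ofReal_re]; linarith
    · simp only [Complex.neg_re, Complex.ofReal_re]; linarith
    · simp only [Complex.neg_im, Complex.ofReal_im, neg_zero, abs_zero]; linarith
  have hzero : ∀ y : ℝ, |y| ≤ kappa166 (d + 1) → h (-Real.pi + y * I) = 0 := by
    intro y hy
    have hs := W166Inf_sides (kappa166_pos _).le le_rfl hμν i hq hy
    simp only [hh, sliceW]
    have e : (-(Real.pi : ℂ) + y * I) + 2 * Real.pi = Real.pi + y * I := by ring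
    rw [e, hs, sub_self]
  have hfreq : ∃ᶠ w in 𝓝[≠] (-(Real.pi : ℂ)), h w = 0 := by
    rw [Filter.frequently_iff]
    intro V hV
    obtain ⟨ε, hε, hVsub⟩ := Metric.mem_nhdsWithin_iff.mp hV
    set y : ℝ := min (ε / 2) (kappa166 (d + 1)) with hy
    have hy0 : 0 < y := lt_min (by linarith) hκ
    have hyε : y < ε := by have := min_le_left (ε / 2) (kappa166 (d + 1)); linarith
    have hyκ : |y| ≤ kappa166 (d + 1) := by rw [abs_of_pos hy0]; exact min_le_right _ _
    refine ⟨-Real.pi + y * I, hVsub ⟨?_, ?_⟩, hzero y hyκ⟩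
    · rw [mem_ball, Complex.dist_eq]
      have : (-(Real.pi : ℂ) + y * I) - -(Real.pi : ℂ) = y * I := by ring
      rw [this, norm_mul, Complex.norm_I, mul_one, Complex.norm_real, Real.norm_eq_abs, abs_of_pos hy0]
      exact hyε
    · intro heq
      have h1 := congrArg Complex.im heq
      simp only [Complex.add_im, Complex.neg_im, Complex.ofReal_im, neg_zero, Complex.mul_im, Complex.ofReal_re, Complex.I_im,
        mul_one, Complex.I_re, mul_zero, add_zero, zero_add] at h1
      exact hy0.ne' h1
  have hEq := han.eqOn_zero_of_preconnected_of_frequently_eq_zero (isPreconnected_sideNbhd _ _) h0U hfreq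
  have := hEq hz
  simp only [hh, Pi.zero_apply, sub_eq_zero] at this
  exact this

/-- [folklore] consequently every slice DERIVATIVE is `2π`-periodic near the left side: `iteratedDeriv j sliceW (z + 2π) = iteratedDeriv j sliceW z`
for `z` in the side neighbourhood. -/
theorem iteratedDeriv_sliceW_add_two_pi (j : ℕ) {μ ν : Fin (d + 1)} (hμν : μ ≠ ν) (i : Fin (d + 1)) {q : Fin d → ℝ} (hq : q ∈ BZ d) {z : ℂ}
    (hz : z ∈ sideNbhd (kappa166 (d + 1)) (delta166 (d + 1))) :
    iteratedDeriv j (sliceW μ ν i q) (z + 2 * Real.pi) = iteratedDeriv j (sliceW μ ν i q) z := by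
  have hEqOn : Set.EqOn (fun w => sliceW μ ν i q (w + 2 * Real.pi)) (sliceW μ ν i q) (sideNbhd (kappa166 (d + 1)) (delta166 (d + 1))) :=
    fun w hw => sliceW_add_two_pi hμν i hq hw
  have h := hEqOn.iteratedDeriv_of_isOpen (isOpen_sideNbhd _ _) j hz
  rw [iteratedDeriv_comp_add_const] at h
  exact h

/-- [folklore] **ENDPOINT MATCHING OF ALL SLICE DERIVATIVES** (hypothesis `hper` of the integration-by-parts engines, for every member of the chain):
`DW j μ ν i (insertNth i (−π) q) = DW j μ ν i (insertNth i π q)` for `μ ≠ ν`, `q ∈ [-π,π]^d`, every `j`. -/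
theorem DW_periodic (j : ℕ) {μ ν : Fin (d + 1)} (hμν : μ ≠ ν) (i : Fin (d + 1)) {q : Fin d → ℝ} (hq : q ∈ BZ d) :
    DW j μ ν i (i.insertNth (((-Real.pi : ℝ)) : ℂ) (ofRealVec q)) = DW j μ ν i (i.insertNth ((Real.pi : ℝ) : ℂ) (ofRealVec q)) := by
  rw [DW_insertNth, DW_insertNth]
  have hκ := kappa166_pos (d + 1)
  have hδ := delta166_pos (d + 1)
  have hz : ((-Real.pi : ℝ) : ℂ) ∈ sideNbhd (kappa166 (d + 1)) (delta166 (d + 1)) := by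
    refine ⟨?_, ?_, ?_⟩
    · rw [Complex.ofReal_re]; linarith
    · rw [Complex.ofReal_re]; linarith
    · rw [Complex.ofReal_im, abs_zero]; linarith
  have h := iteratedDeriv_sliceW_add_two_pi j hμν i hq hz
  have e : ((-Real.pi : ℝ) : ℂ) + 2 * Real.pi = ((Real.pi : ℝ) : ℂ) := by push_cast; ring
  rw [e] at h
  exact h.symm

/-! ## §5 Evenness in the coordinate and the first-order vanishing of `∂_i W_∞` -/

/-- [folklore] flipping coordinate `i` of the inserted point negates the inserted value. -/
theorem cflip_insertNth (i : Fin (d + 1)) (z : ℂ) (c : Fin d → ℂ) : cflip i (i.insertNth z c) = i.insertNth (-z) c := by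
  funext j
  refine Fin.succAboveCases i ?_ ?_ j
  · simp [cflip, Fin.insertNth_apply_same]
  · intro k
    simp [cflip, Fin.insertNth_apply_succAbove, Fin.succAbove_ne i k]

/-- [folklore] **EVENNESS OF THE SLICE**: `sliceW μ ν i q (−z) = sliceW μ ν i q z` (`W166Inf_cflip`). -/
theorem sliceW_neg (μ ν i : Fin (d + 1)) (q : Fin d → ℝ) (z : ℂ) : sliceW μ ν i q (-z) = sliceW μ ν i q z := by
  unfold sliceW
  rw [← cflip_insertNth, W166Inf_cflip]

/-- [folklore] the first slice derivative vanishes at the centre: `iteratedDeriv 1 sliceW 0 = 0` (odd function of an even one). -/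
theorem iteratedDeriv_one_sliceW_zero (μ ν i : Fin (d + 1)) (q : Fin d → ℝ) : iteratedDeriv 1 (sliceW μ ν i q) 0 = 0 := by
  have h := iteratedDeriv_comp_neg 1 (sliceW μ ν i q) 0
  have e : (fun x => sliceW μ ν i q (-x)) = sliceW μ ν i q := funext fun x => sliceW_neg μ ν i q x
  rw [e, neg_zero, pow_one, neg_one_smul] at h
  -- `a = -a` ⟹ `a = 0`
  have : (2 : ℂ) * iteratedDeriv 1 (sliceW μ ν i q) 0 = 0 := by linear_combination h
  simpa using this

/-- [folklore] **`∂_i W_∞ = 0` ON THE HYPERPLANE `s_i = 0`**: `DW 1 μ ν i (insertNth i 0 q) = 0`. -/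
theorem DW_one_center (μ ν i : Fin (d + 1)) (q : Fin d → ℝ) : DW 1 μ ν i (i.insertNth (0 : ℂ) (ofRealVec q)) = 0 := by
  rw [DW_insertNth]; exact iteratedDeriv_one_sliceW_zero μ ν i q

/-- [folklore] **FIRST-ORDER VANISHING OF `∂_i W_∞` ALONG THE COORDINATE**: for `q ∈ [-π,π]^d`, `t ∈ [-π, π]`,
`‖DW 1 μ ν i (insertNth i t q)‖ ≤ (2·M₁₆₆∕(δ₁₆₆∕2)²)·|t|` (mean value inequality on `[-π, π]` from `DW_one_center` and the `j = 2` Cauchy bound). -/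
theorem norm_DW_one_le_mul_abs (μ ν i : Fin (d + 1)) {q : Fin d → ℝ} (hq : q ∈ BZ d) {t : ℝ} (ht : t ∈ Set.Icc (-Real.pi) Real.pi) :
    ‖DW 1 μ ν i (i.insertNth (t : ℂ) (ofRealVec q))‖ ≤ (2 * bound166 (d + 1) / (delta166 (d + 1) / 2) ^ 2) * |t| := by
  set f : ℝ → ℂ := fun s => DW 1 μ ν i (i.insertNth (s : ℂ) (ofRealVec q)) with hf
  have hδ := delta166_pos (d + 1)
  have hder : ∀ s ∈ Set.Icc (-Real.pi) Real.pi,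
      HasDerivWithinAt f (DW 2 μ ν i (i.insertNth (s : ℂ) (ofRealVec q))) (Set.Icc (-Real.pi) Real.pi) s := by
    intro s hs
    have hs' : |s| < Real.pi + delta166 (d + 1) := by have := abs_le.mpr ⟨hs.1, hs.2⟩; linarith
    exact (hasDerivAt_DW_ofReal 1 μ ν i hq hs').hasDerivWithinAt
  have hbound : ∀ s ∈ Set.Icc (-Real.pi) Real.pi,
      ‖DW 2 μ ν i (i.insertNth (s : ℂ) (ofRealVec q))‖ ≤ 2 * bound166 (d + 1) / (delta166 (d + 1) / 2) ^ 2 := by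
    intro s hs
    have h := norm_DW_insertNth_le 2 μ ν i hq hs
    simpa [Nat.factorial] using h
  have h0 : (0 : ℝ) ∈ Set.Icc (-Real.pi) Real.pi := ⟨by linarith [Real.pi_pos], Real.pi_pos.le⟩
  have hmv := Convex.norm_image_sub_le_of_norm_hasDerivWithin_le hder hbound (convex_Icc _ _) h0 ht
  have hf0 : f 0 = 0 := by simp only [hf, Complex.ofReal_zero]; exact DW_one_center μ ν i q
  rw [hf0, sub_zero] at hmv
  simpa [Real.norm_eq_abs] using hmv

end Summit.QuantumFields.BalabanUV.Beta.FP.PerfectSymbol166RealLine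

end
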